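import Summits.BirchSwinnertonDyer.Rank2.LevelFifteenManinDescent
import HarnessLib

/-!
# Manin symbols on `Γ₀(15)`, III: the EXACT Euclid descent — computable lattice coordinates of every `{∞, k∞}_h`

Cell `bsd-rank2` (D-0036), seat `bsd-rank2-eng` GEN 9 (director-bsd g9 ruling (R3), 2026-08-27T14:45:57Z: the BC5 rung
«(★_S) mod T⁸ on 15A8 via the level-15 presentation» for the line `star` of crux E1M, stmt-BirchSwinnertonDyer-20341).

GEN 8's `inftySymbol_decomp` gives, for every `k = (a b; c d) ∈ SL(2, ℤ)` and `h ∈ S₂(Γ₀(15))`,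
`{∞, k∞}_h = W_{cls(c,d)}(h) + n₁E₁(h) + n₂E₂(h)` with `n₁` known only MODULO `2` (enough for X₂ = the `T`-order of
`L₂(15A8)`). Any higher rung of the mod-`2` Eisenstein identity (★) needs the `2`-adic `L`-function of `15A8` modulo `2`
after removing its unit content, i.e. the modular symbols `{∞, a/2^m}` EXACTLY (the unit root `α` of `X² + X + 2` has
`v₂(α − 1) = 2`, which pushes the unit content two bits below the parity datum). This file makes the descent exact and
COMPUTABLE:

* `descentF` / `descent` — a structurally recursive integer function of the bottom row `(c, d)` (Euclid: `d = qc + r`,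
  `k ↦ kT^{−q}S`; the `T^{±q}`-correction is the sum `tCorr` of at most `14` table entries `tA1/tA2`, since the class of
  `(c, d + jc)` mod `15` is `15`-periodic in `j`; the `S`-correction is `sA1/sA2`), and
* `inftySymbol_eq_descent` — **`{∞, k∞}_h = W_{cls(c,d)}(h) + (descent c d).1 · E₁(h) + (descent c d).2 · E₂(h)`** for
  every `k ∈ SL(2, ℤ)` (same induction as GEN 8, with the 48 certified move identities used as EQUALITIES);
* `modularSymbol_eq_modularSymbol_zero_add` — for a cusp `a/c` with `ad − bc = 1`, `c ≠ 0` and `15 ∣ d` (always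
  arrangeable when `gcd(c, 15) = 1`, e.g. `c = 2^m`): **`{∞, a/c}_h = {∞, 0}_h + (descent c d).1 · E₁(h) + (descent c d).2 · E₂(h)`**
  — the class of `(c, 0)` is that of `S`, whose chain value is `{∞, 0}_h`;
* `descent_two_fifteen` etc. — sample evaluations by `decide` (`{∞, 1/2} = {∞, 0} + …`), the shape in which the
  Mazur–Tate Riemann sums of `15A8` at level `2^m` become explicit elements of `ℤ[α]·E₁ ⊕ ℤ[α]·E₂ + ℤ[α]·{∞,0}`.

DEFINITIONS + THEOREMS (computable `def`s `clsInt`, `tCorr`, `descentF`, `descent`; no named fact, no `sorry`). PARTITION: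
none — r_an ≥ 2, summit axis S0; TWIN (D-0056): n/a. B1 honesty: linear algebra of M-symbols at level `15`; nothing here
reads an analytic rank; no S0 motion.

References: Ju. I. Manin, *Izv. Akad. Nauk SSSR* 36 (1972) Thm. 1.6, Thm. 1.9 [Manin1972]; J. E. Cremona, *Algorithms for
modular elliptic curves* (1997) §2.2–§2.3, §2.8 [CremonaAlgorithms1997].
-/

open scoped MatrixGroups ModularForm

namespace Summit.BirchSwinnertonDyer.Rank2.LevelFifteen

/-! ### §1 The computable descent -/

/-- The class in `ℙ¹(ℤ/15)` (index into the 24 M-symbol classes) of an integer bottom row `(c, d)`.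
[cite: CremonaAlgorithms1997, §2.2] -/
def clsInt (c d : ℤ) : Fin 24 := clsTab ((c : ZMod 15)) ((d : ZMod 15))

/-- The lattice correction of `j` successive `T`-moves starting from the row `(c, d)`:
`Σ_{i<j} (tA1, tA2)(cls(c, d + i·c))`. [cite: Manin1972, Thm. 1.6] -/
def tCorr (c d : ℤ) : ℕ → ℤ × ℤ
  | 0 => (0, 0)
  | j + 1 => tCorr c d j + (tA1 (clsInt c (d + j * c)), tA2 (clsInt c (d + j * c)))

/-- The exact Euclid descent with fuel `n` (any `n > |c|` gives the same, correct value): for `c = 0` the coordinates are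
`(0, 0)`; otherwise write `d = qc + r` (`q = d / c`, `r = d % c`, `0 ≤ r < |c|`), descend to the row `(r, −c)` of `kT^{−q}S`,
undo the `S`-move (`− (sA1, sA2)(cls(c, r))`) and redo `q mod 15` `T`-moves (`+ tCorr c r (q mod 15)`).
[cite: Manin1972, Thm. 1.6] [cite: CremonaAlgorithms1997, §2.3] -/
def descentF : ℕ → ℤ → ℤ → ℤ × ℤ
  | 0, _, _ => (0, 0)
  | n + 1, c, d =>
    if c = 0 then (0, 0)
    else descentF n (d % c) (-c) - (sA1 (clsInt c (d % c)), sA2 (clsInt c (d % c))) +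
      tCorr c (d % c) ((d / c) % 15).toNat

/-- **The exact descent vector** `descent c d = (n₁, n₂)` of the bottom row `(c, d)`:
`{∞, k∞}_h = W_{cls(c,d)}(h) + n₁E₁(h) + n₂E₂(h)` for every `k = (a b; c d) ∈ SL(2, ℤ)` (`inftySymbol_eq_descent`).
[cite: Manin1972, Thm. 1.6] -/
def descent (c d : ℤ) : ℤ × ℤ := descentF (c.natAbs + 1) c d

/-- Sample values (kernel evaluation): the rows `(2, 15)`, `(4, 15)`, `(8, 15)`, `(16, 15)` of matrices carrying `∞` to
`1/2, 1/4, 1/8, 1/16` (with `d = 15 ≡ 0`, so the base class is that of `S`). [folklore] -/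
theorem descent_samples :
    descent 2 15 = (1, 0) ∧ descent 4 15 = (0, -1) ∧ descent 8 15 = (-1, 0) ∧ descent 16 15 = (0, 0) := by
  decide

noncomputable section

open CongruenceSubgroup Matrix.SpecialLinearGroup ModularGroup
open Literature.NumberTheory.EllipticCurves.ModularForms

variable (h : CuspForm (Gamma0 15) 2)

/-! ### §2 The two moves as exact identities -/

/-- Bottom row of `k·T`: `(c, c + d)`. [folklore] -/
theorem mul_T_apply_10 (k : SL(2, ℤ)) : (k * T) 1 0 = k 1 0 := by
  simp [coe_T, Matrix.mul_apply, Fin.sum_univ_two]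

/-- Bottom row of `k·T`: `(c, c + d)`. [folklore] -/
theorem mul_T_apply_11 (k : SL(2, ℤ)) : (k * T) 1 1 = k 1 0 + k 1 1 := by
  simp [coe_T, Matrix.mul_apply, Fin.sum_univ_two]

/-- Bottom row of `k·Tʲ`: `(c, d + j c)`. [folklore] -/
theorem mul_T_pow_apply (k : SL(2, ℤ)) (j : ℕ) :
    (k * T ^ j) 1 0 = k 1 0 ∧ (k * T ^ j) 1 1 = k 1 1 + j * k 1 0 := by
  induction j with
  | zero => simp
  | succ j ih =>
    rw [pow_succ, ← mul_assoc, mul_T_apply_10, mul_T_apply_11, ih.1, ih.2]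
    exact ⟨rfl, by push_cast; ring⟩

/-- **Exact `T`-move**: a decomposition of `{∞, k∞}` over the class of `(c, d)` gives the decomposition of `{∞, kT∞}`
(the same number) over the class `cls(c, c + d) = cls(c,d)·T`, the coordinates moving by `(tA1, tA2)(cls(c,d))`
(`W_sub_W_tIdx`). [cite: Manin1972, Thm. 1.6] -/
theorem inftySymbol_mul_T_of_eq {k : SL(2, ℤ)} {u v : ℤ}
    (hk : inftySymbol h k = W h (clsInt (k 1 0) (k 1 1)) + (u : ℂ) * E₁ h + (v : ℂ) * E₂ h) :
    inftySymbol h (k * T) = W h (clsInt ((k * T) 1 0) ((k * T) 1 1)) +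
      ((u + tA1 (clsInt (k 1 0) (k 1 1)) : ℤ) : ℂ) * E₁ h + ((v + tA2 (clsInt (k 1 0) (k 1 1)) : ℤ) : ℂ) * E₂ h := by
  obtain ⟨hcls, -⟩ := tab_T_int (k 1 0) (k 1 1) (adm_three k) (adm_five k)
  set P := clsInt (k 1 0) (k 1 1) with hP
  have hW := W_sub_W_tIdx h P
  have hcls' : clsInt ((k * T) 1 0) ((k * T) 1 1) = tIdx P := by
    rw [mul_T_apply_10, mul_T_apply_11, hP, clsInt, clsInt]; exact hcls
  rw [inftySymbol_mul_T, hcls', hk]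
  push_cast
  linear_combination hW

/-- **Exact `Tʲ`-move** (`j ≥ 0` steps): the coordinates move by `tCorr c d j`. [cite: Manin1972, Thm. 1.6] -/
theorem inftySymbol_mul_T_pow_of_eq {k : SL(2, ℤ)} {u v : ℤ}
    (hk : inftySymbol h k = W h (clsInt (k 1 0) (k 1 1)) + (u : ℂ) * E₁ h + (v : ℂ) * E₂ h) (j : ℕ) :
    inftySymbol h (k * T ^ j) = W h (clsInt ((k * T ^ j) 1 0) ((k * T ^ j) 1 1)) +
      ((u + (tCorr (k 1 0) (k 1 1) j).1 : ℤ) : ℂ) * E₁ h + ((v + (tCorr (k 1 0) (k 1 1) j).2 : ℤ) : ℂ) * E₂ h := by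
  induction j with
  | zero => simpa [tCorr] using hk
  | succ j ih =>
    have hstep := inftySymbol_mul_T_of_eq h ih
    rw [pow_succ, ← mul_assoc]
    rw [hstep, (mul_T_pow_apply k j).1, (mul_T_pow_apply k j).2]
    simp only [tCorr, Prod.fst_add, Prod.snd_add]
    push_cast
    ring

/-- **Exact `S`-move**: a decomposition of `{∞, kS∞}` over the class `cls(d, −c) = cls(c,d)·S` gives the decomposition
of `{∞, k∞} = [k] + {∞, kS∞}` over `cls(c, d)`, the coordinates moving by `−(sA1, sA2)(cls(c,d))`
(`W_sub_xval_sub_W_sIdx`). [cite: Manin1972, Thm. 1.6] -/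
theorem inftySymbol_of_mul_S_eq {k : SL(2, ℤ)} {u v : ℤ}
    (hk : inftySymbol h (k * S) = W h (clsInt ((k * S) 1 0) ((k * S) 1 1)) + (u : ℂ) * E₁ h + (v : ℂ) * E₂ h) :
    inftySymbol h k = W h (clsInt (k 1 0) (k 1 1)) +
      ((u - sA1 (clsInt (k 1 0) (k 1 1)) : ℤ) : ℂ) * E₁ h + ((v - sA2 (clsInt (k 1 0) (k 1 1)) : ℤ) : ℂ) * E₂ h := by
  rw [mul_S_apply_10, mul_S_apply_11] at hk
  obtain ⟨hcls, -⟩ := tab_S_int (k 1 0) (k 1 1) (adm_three k) (adm_five k)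
  set P := clsInt (k 1 0) (k 1 1) with hP
  have hW := W_sub_xval_sub_W_sIdx h P
  have hM : msymbolSL h k = xval h P := msymbolSL_eq_xval h k
  have hdef : inftySymbol h k = msymbolSL h k + inftySymbol h (k * S) := by rw [msymbolSL]; ring
  have hcls' : clsInt (k 1 1) (-k 1 0) = sIdx P := by rw [hP, clsInt, clsInt]; exact hcls
  rw [hcls'] at hk
  rw [hdef, hM, hk]
  push_cast
  linear_combination -hW

/-! ### §3 The descent theorem -/

/-- The base class: for `c = 0` (so `d = ±1`) the class is `0`, whose chain is empty: `W₀ = 0`. [folklore] -/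
theorem W_clsInt_zero_eq_zero {d : ℤ} (hd : d = 1 ∨ d = -1) : W h (clsInt 0 d) = 0 := by
  obtain ⟨h01, h0m1, -, -, hchain⟩ := tab_base
  have hW0 : W h 0 = 0 := by
    unfold W ev; exact Finset.sum_eq_zero fun i _ ↦ by rw [hchain i]; simp
  rcases hd with rfl | rfl
  · rw [clsInt, h01, hW0]
  · rw [clsInt, h0m1, hW0]

/-- **The exact descent, fuelled form**: for every `n > |c|`,
`{∞, k∞}_h = W_{cls(c,d)}(h) + (descentF n c d).1 · E₁(h) + (descentF n c d).2 · E₂(h)`. Strong induction on `|c|` as in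
`inftySymbol_decomp`, with the move identities used as equalities. [cite: Manin1972, Thm. 1.6] -/
theorem inftySymbol_eq_descentF (n : ℕ) : ∀ (k : SL(2, ℤ)), (k 1 0).natAbs < n →
    inftySymbol h k = W h (clsInt (k 1 0) (k 1 1)) +
      ((descentF n (k 1 0) (k 1 1)).1 : ℂ) * E₁ h + ((descentF n (k 1 0) (k 1 1)).2 : ℂ) * E₂ h := by
  induction n with
  | zero => intro k hk; exact absurd hk (Nat.not_lt_zero _)
  | succ n ih =>
    intro k hk
    by_cases hc0 : k 1 0 = 0
    · -- base: `k = ±T^b`, `{∞, k∞} = 0`, class `0`, `W₀ = 0`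
      have hdet := Matrix.SpecialLinearGroup.det_coe k
      rw [Matrix.det_fin_two, hc0, mul_zero, sub_zero] at hdet
      have hinf : inftySymbol h k = 0 := by simp [inftySymbol, hc0]
      have hd : k 1 1 = 1 ∨ k 1 1 = -1 := by
        rcases Int.eq_one_or_neg_one_of_mul_eq_one' hdet with ⟨-, hd⟩ | ⟨-, hd⟩
        · exact Or.inl hd
        · exact Or.inr hd
      rw [hinf, hc0, W_clsInt_zero_eq_zero h hd]
      simp [descentF]
    · -- Euclid step
      set c : ℤ := k 1 0 with hcdef
      set d : ℤ := k 1 1 with hddef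
      have hrd : d = (d / c) * c + d % c := by
        have := Int.emod_add_mul_ediv d c
        linarith
      have hr_lt : (d % c).natAbs < n := by
        have h1 : 0 ≤ d % c := Int.emod_nonneg d hc0
        have h2 : d % c < |c| := Int.emod_lt_abs d hc0
        have : (d % c).natAbs < c.natAbs := by
          rw [← Int.ofNat_lt]; rw [Int.natAbs_of_nonneg h1, ← Int.abs_eq_natAbs]; exact h2
        omega
      -- `k₁ = k T^{-q}` has bottom row `(c, r)`; `k₂ = k₁ S` has bottom row `(r, -c)`
      set k₁ : SL(2, ℤ) := k * T ^ (-(d / c)) with hk₁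
      have hk₁10 : k₁ 1 0 = c := by
        rw [hk₁]; simp [coe_T_zpow, Matrix.mul_apply, Fin.sum_univ_two, ← hcdef]
      have hk₁11 : k₁ 1 1 = d % c := by
        rw [hk₁]; simp [coe_T_zpow, Matrix.mul_apply, Fin.sum_univ_two, ← hcdef, ← hddef]
        linear_combination hrd
      set k₂ : SL(2, ℤ) := k₁ * S with hk₂
      have hk₂10 : k₂ 1 0 = d % c := by rw [hk₂, mul_S_apply_10, hk₁11]
      have ih₂ := ih k₂ (by rw [hk₂10]; exact hr_lt)
      -- undo the `S`-move, then redo `q mod 15` `T`-moves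
      have h₁ := inftySymbol_of_mul_S_eq h (k := k₁) ih₂
      have h₃ := inftySymbol_mul_T_pow_of_eq h h₁ ((d / c) % 15).toNat
      set qp : ℕ := ((d / c) % 15).toNat with hqp
      -- the rows after the moves
      rw [(mul_T_pow_apply k₁ qp).1, (mul_T_pow_apply k₁ qp).2, hk₁10, hk₁11, hk₂, mul_S_apply_10, mul_S_apply_11,
        hk₁10, hk₁11] at h₃
      -- `{∞, k₁ T^{qp} ∞} = {∞, k∞}`
      have hsym : inftySymbol h (k₁ * T ^ qp) = inftySymbol h k := by
        rw [← zpow_natCast, inftySymbol_mul_T_zpow, hk₁, inftySymbol_mul_T_zpow]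
      -- the class of `(c, r + qp·c)` is that of `(c, d)`: `qp ≡ q (mod 15)`
      have hqp15 : (qp : ℤ) = (d / c) % 15 := by
        rw [hqp, Int.toNat_of_nonneg (Int.emod_nonneg _ (by norm_num))]
      have hcls : clsInt c (d % c + (qp : ℤ) * c) = clsInt c d := by
        have h15' : (d / c) % 15 = d / c - 15 * ((d / c) / 15) := Int.emod_def _ _
        have e : ((d % c + (qp : ℤ) * c : ℤ) : ZMod 15) = ((d : ℤ) : ZMod 15) := by
          rw [ZMod.intCast_eq_intCast_iff_dvd_sub]
          exact ⟨(d / c) / 15 * c, by push_cast; linear_combination hrd - c * hqp15 - c * h15'⟩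
        unfold clsInt
        rw [e]
      -- unfold one step of the descent
      have hdesc : descentF (n + 1) c d =
          descentF n (d % c) (-c) - (sA1 (clsInt c (d % c)), sA2 (clsInt c (d % c))) + tCorr c (d % c) qp := by
        rw [descentF, if_neg hc0]
      rw [← hsym, h₃, hcls, hdesc]
      simp only [Prod.fst_add, Prod.snd_add, Prod.fst_sub, Prod.snd_sub]

/-- **The exact descent**: `{∞, k∞}_h = W_{cls(c,d)}(h) + (descent c d).1 · E₁(h) + (descent c d).2 · E₂(h)` for every
`k = (a b; c d) ∈ SL(2, ℤ)` and every `h ∈ S₂(Γ₀(15))`. [cite: Manin1972, Thm. 1.6] -/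
theorem inftySymbol_eq_descent (k : SL(2, ℤ)) :
    inftySymbol h k = W h (clsInt (k 1 0) (k 1 1)) +
      ((descent (k 1 0) (k 1 1)).1 : ℂ) * E₁ h + ((descent (k 1 0) (k 1 1)).2 : ℂ) * E₂ h :=
  inftySymbol_eq_descentF h _ k (Nat.lt_succ_self _)

/-! ### §4 Cusps `a/c`, normalised to the class of `S` -/

/-- The representative of class `1` is `S`. [folklore] -/
theorem rep_one_eq_S : rep 1 = S := by
  ext i j
  fin_cases i <;> fin_cases j <;> rfl

/-- The chain of class `1` is the single symbol of class `1`: `W₁(h) = x₁(h) = [S]_h = {∞, 0}_h`. [cite: CremonaAlgorithms1997, §2.3] -/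
theorem W_one_eq_modularSymbol_zero : W h 1 = modularSymbol h 0 := by
  have hchain : ∀ i : Fin 24, chainTab 1 i = if i = 1 then 1 else 0 := by decide
  have hW : W h 1 = xval h 1 := by
    unfold W ev
    rw [Finset.sum_eq_single (1 : Fin 24)]
    · rw [hchain 1, if_pos rfl]; simp
    · intro i _ hi; rw [hchain i, if_neg hi]; simp
    · intro h1; exact absurd (Finset.mem_univ _) h1
  rw [hW, xval, rep_one_eq_S, msymbolSL]
  have h1 : inftySymbol h S = modularSymbol h 0 := by
    simp [inftySymbol, coe_S]
  have h2 : inftySymbol h (S * S) = 0 := by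
    have : ((S * S : SL(2, ℤ)) : Matrix (Fin 2) (Fin 2) ℤ) 1 0 = 0 := by
      simp [coe_S, Matrix.mul_apply, Fin.sum_univ_two]
    simp [inftySymbol, this]
  rw [h1, h2, sub_zero]

/-- For `c` prime to `15`, the class of `(c, 0)` is the class of `S`. [folklore] -/
theorem clsTab_zero_eq_one : ∀ c : Fin 15, ¬ (c.val % 3 = 0 ∧ (0 : Fin 15).val % 3 = 0) →
    ¬ (c.val % 5 = 0 ∧ (0 : Fin 15).val % 5 = 0) → clsTab c 0 = 1 := by
  decide

/-- **`{∞, a/c}_h = {∞, 0}_h + n₁E₁(h) + n₂E₂(h)` with `(n₁, n₂) = descent c d`**, for every `a, b, c, d ∈ ℤ` with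
`ad − bc = 1`, `c ≠ 0` and `15 ∣ d` (so `gcd(c, 15) = 1`; for such `c` a `d ≡ 0 (mod 15)` with `ad ≡ 1 (mod c)` always exists).
The cusp `a/c` is then `Γ₀(15)`-equivalent to `0` and `{0, a/c}` is the closed cycle `n₁e₁ + n₂e₂`.
[cite: Manin1972, Thm. 1.6] [cite: CremonaAlgorithms1997, §2.2–§2.3, §2.8] -/
theorem modularSymbol_eq_modularSymbol_zero_add (a b c d : ℤ) (hdet : a * d - b * c = 1) (hc : c ≠ 0)
    (h15 : (15 : ℤ) ∣ d) :
    modularSymbol h ((a : ℚ) / (c : ℚ)) =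
      modularSymbol h 0 + ((descent c d).1 : ℂ) * E₁ h + ((descent c d).2 : ℂ) * E₂ h := by
  set k : SL(2, ℤ) := ⟨!![a, b; c, d], by rw [Matrix.det_fin_two_of]; linear_combination hdet⟩ with hk
  have hk00 : k 0 0 = a := rfl
  have hk10 : k 1 0 = c := rfl
  have hk11 : k 1 1 = d := rfl
  have hmain := inftySymbol_eq_descent h k
  rw [hk10, hk11] at hmain
  have hinf : inftySymbol h k = modularSymbol h ((a : ℚ) / (c : ℚ)) := by
    rw [inftySymbol, if_neg (by rw [hk10]; exact hc), hk00, hk10]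
  have hd0 : ((d : ℤ) : ZMod 15) = ((0 : ℤ) : ZMod 15) := by
    rw [ZMod.intCast_eq_intCast_iff_dvd_sub]; simpa using h15
  have hcls : clsInt c d = 1 := by
    have h3 := adm_three k; have h5 := adm_five k
    rw [hk10, hk11, hd0, Int.cast_zero] at h3 h5
    rw [clsInt, hd0, Int.cast_zero]
    exact clsTab_zero_eq_one _ h3 h5
  rw [← hinf, hmain, hcls, W_one_eq_modularSymbol_zero]

/-- The cusp `1/2`: `{∞, 1/2}_h = {∞, 0}_h + E₁(h)` (`k = (1 7; 2 15)`). [folklore] -/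
theorem modularSymbol_half : modularSymbol h (1 / 2 : ℚ) = modularSymbol h 0 + E₁ h := by
  have hmain := modularSymbol_eq_modularSymbol_zero_add h 1 7 2 15 (by norm_num) (by norm_num) ⟨1, by norm_num⟩
  rw [descent_samples.1] at hmain
  push_cast at hmain
  simpa using hmain

end

end Summit.BirchSwinnertonDyer.Rank2.LevelFifteen
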